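import Literature.Geometry.Lorentzian.CoordCurvature
import Literature.Geometry.Lorentzian.KerrConvergence
import Literature.Geometry.Lorentzian.KerrSchildChartCovariance
import Literature.Geometry.Lorentzian.MultiCentreKerrSchild
import Summits.FinalStateConjecture.FinalStateConjecture.Theorems.EIHFluxBalanceInertialRecessionStubSlavingCoercivity
import Summits.FinalStateConjecture.FinalStateConjecture.Theorems.ClusterCompletenessOmegaLimitMultiKerrOmegaLimitGlue
import HarnessLib

/-!
# Route ClusterCompleteness · crux `OmegaLimitMultiKerr` — anchored ω-limits are metrics where the
# reference margin beats the anchor (invertibility and symmetry of limit chart metrics)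

Structure lemmas for the crux stmt-FinalStateConjecture-14664 (`ClusterCompleteness.OmegaLimitMultiKerr`,
rank 9), line `Sketch`, lead gen 3, registered stub `isInvertible_add_of_norm_lt_margin` (closed
form).

The vacuum-limit composite `ricAt_hole_omegaLimit_eq_zero` (`…VacuumOmegaLimits`) needs the limit
chart metric `g + g_{M,a,Λ,c}` of an ω-limit `g` of the deviation translates of a hole chart to be a
field of metric components, `MetricCoord.IsMetricOn`: `C^∞` (`…SmoothOmegaLimits`), SYMMETRIC and
INVERTIBLE. The crux's all-time `C⁰` anchor `‖Ψ^* 𝐠 − g_{M,a}‖ ≤ 1/4` passes to ω-limits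
(`norm_omegaLimit_le_of_tendsto_supCkENorm`, `…OmegaLimitGlue`); this file turns
"anchor < nondegeneracy margin of the reference form" into invertibility, and records symmetry:

* `mul_norm_le_norm_add_apply`, `injective_add_of_norm_lt` — general real normed spaces `E`, `F`:
  a lower bound `m‖v‖ ≤ ‖A v‖` survives a perturbation `P` as `(m − ‖P‖)‖v‖ ≤ ‖(A + P) v‖`, so
  `A + P` is injective for `‖P‖ < m`;
* `isInvertible_add_of_norm_lt_margin` (MAIN, registered) — for bilinear forms
  `A P : E →L E →L ℝ` on a finite-dimensional `E`: `m‖v‖ ≤ ‖A v‖` for all `v` and `‖P‖ < m` ⇒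
  `A + P` invertible as a map `E → E*` (injective ⇒ nondegenerate ⇒ invertible,
  `MetricCoord.isInvertible_of_nondegenerate`; O'Neill 1983, Ch. 3, Lemma 3.4) — no Neumann series;
  `isInvertible_add_of_norm_le_mul` (margin phrased as `‖v‖ ≤ L‖A v‖`, `‖P‖ L < 1`) and
  `isInvertible_add_of_isInvertible` (`A` invertible, `‖P‖ ‖A⁻¹‖ < 1`) are the usual readings;
* `symm_of_tendsto` — a limit (along any nontrivial filter) of eventually symmetric bilinear forms
  is symmetric (evaluation is continuous; extends `Literature.Geometry.Lorentzian.symm_of_tendsto_bilin`,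
  stated for sequences symmetric at every index, to filters);
* the crux setting (`B = boostedKerrBilin Λ c M a`, the deviation `Ψ^* 𝐠 − B` of a hole chart `Ψ` on
  `boostedKerrBackground Λ c M a`): `deviationExtend_symm` (the deviation from a symmetric reference
  is symmetric everywhere), `symm_add_boostedKerrBilin_of_tendsto` (so is `G + B x` for every limit
  `G` of deviation values), `isInvertible_add_boostedKerrBilin_of_norm_lt` /
  `…_of_mul_lt_one` (margin `m` resp. the explicit Kerr–Schild margin
  `‖v‖ ≤ ‖Λ‖²(1 + 4|H|)‖B x v‖` of `SublinearIsFree.Slaving.norm_le_mul_norm_boostedKerrBilin`),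
  `isInvertible_add_boostedKerrBilin_of_tendsto` (an eventual bound `‖Gᵢ‖ ≤ cst < m` on the
  approximants: ANCHORED ω-LIMITS ARE NONDEGENERATE where the margin beats the anchor), and the
  assembled `isMetricOn_omegaLimit_add_boostedKerrBilin` (any filter of translates) /
  `isMetricOn_hole_omegaLimit_add_boostedKerrBilin` (the sequential `supCkENorm`-on-compacts currency
  of `exists_smoothOmegaLimit_hole_translate` / `ricAt_hole_omegaLimit_eq_zero`).

Numerically the Kerr–Schild margin at the horizon is `0.41` at rest (`a = 0`) but drops below `1/4`
for boost speeds `v ≳ 0.3` (line card `Lines/Sketch.md`, cycle 3), so the margin hypothesis is a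
genuine restriction of the region `V`, not automatic from the anchor. Everything is proved;
Mathlib + landed `Literature` / `Theorems` files only, no definitions.

## References
* B. O'Neill, *Semi-Riemannian geometry with applications to relativity*, Academic Press 1983,
  Ch. 3, Def. 3.1 and Lemma 3.4 (metric tensors: symmetric nondegenerate, nondegenerate ⇔ invertible
  matrix). [ONeill1983]
* J. K. Hale, *Ordinary differential equations*, 2nd ed., Krieger 1980, Ch. I, §8 (ω-limit sets
  inherit closed constraints). [Hale1980]
-/

-- every `Summit.FinalStateConjecture.FinalStateConjecture.…` name repeats the summit = sub-problem segment (D-0017 layout)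
set_option linter.dupNamespace false
-- the normed-group instances on `E →L[ℝ] E →L[ℝ] ℝ` need one more level of pending instance
-- problems than the default (as in `CoordCurvature.lean`)
set_option maxSynthPendingDepth 3

noncomputable section

open scoped Manifold ContDiff Topology ENNReal
open Set Filter TopologicalSpace

namespace Summit.FinalStateConjecture.FinalStateConjecture.Theorems.ClusterCompleteness

open Literature.Geometry.Lorentzian

/-! ### Injectivity and invertibility under perturbations smaller than the margin -/

section General

variable {E F : Type*} [NormedAddCommGroup E] [NormedSpace ℝ E] [NormedAddCommGroup F]
  [NormedSpace ℝ F]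

/-- **A lower bound survives a small perturbation**: if `m‖v‖ ≤ ‖A v‖` for all `v`, then
`(m − ‖P‖)‖v‖ ≤ ‖(A + P) v‖` (`‖A v‖ ≤ ‖(A + P) v‖ + ‖P v‖`, `‖P v‖ ≤ ‖P‖‖v‖`). [folklore] -/
theorem mul_norm_le_norm_add_apply (A P : E →L[ℝ] F) {m : ℝ} (hA : ∀ v : E, m * ‖v‖ ≤ ‖A v‖)
    (v : E) : (m - ‖P‖) * ‖v‖ ≤ ‖(A + P) v‖ := by
  have h1 : ‖P v‖ ≤ ‖P‖ * ‖v‖ := P.le_opNorm v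
  have h2 : ‖A v‖ ≤ ‖(A + P) v‖ + ‖P v‖ :=
    calc ‖A v‖ = ‖(A + P) v - P v‖ := by rw [add_apply, add_sub_cancel_right]
      _ ≤ ‖(A + P) v‖ + ‖P v‖ := norm_sub_le _ _
  rw [sub_mul]
  linarith [hA v]

/-- **`A + P` is injective when `‖P‖` is below the margin of `A`**: `m‖v‖ ≤ ‖A v‖` for all `v` and
`‖P‖ < m` give `(m − ‖P‖)‖v‖ ≤ ‖(A + P) v‖` with `m − ‖P‖ > 0`, so the kernel of `A + P` is trivial.
For bilinear forms `E → E*` this is nondegeneracy of `A + P`. [folklore] -/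
theorem injective_add_of_norm_lt (A P : E →L[ℝ] F) {m : ℝ} (hA : ∀ v : E, m * ‖v‖ ≤ ‖A v‖)
    (hP : ‖P‖ < m) : Function.Injective (A + P) := by
  refine (injective_iff_map_eq_zero (A + P)).2 fun v hv ↦ ?_
  have h := mul_norm_le_norm_add_apply A P hA v
  rw [hv, norm_zero] at h
  have hv0 : ‖v‖ ≤ 0 := by nlinarith [norm_nonneg v, sub_pos.2 hP]
  exact norm_le_zero_iff.1 hv0

/-- **Perturbations below the margin preserve invertibility** (registered structure stub of line
`Sketch`, crux stmt-FinalStateConjecture-14664, closed form). On a finite-dimensional real normed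
space `E`, let `A P : E →L E →L ℝ` be bilinear forms (maps `E → E*`) with `m‖v‖ ≤ ‖A v‖` for all
`v` (a nondegeneracy MARGIN `m` of `A`) and `‖P‖ < m`. Then `A + P` is invertible: it is injective
(`injective_add_of_norm_lt`), i.e. nondegenerate, and in finite dimension nondegenerate forms are
invertible (`MetricCoord.isInvertible_of_nondegenerate`; O'Neill 1983, Ch. 3, Lemma 3.4). This is the
invertibility half of `MetricCoord.IsMetricOn` for limit chart metrics `g + g_{M,a}` of ANCHORED
charts (`‖g‖ ≤ cst`) wherever the margin of the reference form exceeds the anchor.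
[cite: ONeill1983, Ch. 3 Lemma 3.4] -/
theorem isInvertible_add_of_norm_lt_margin : ∀ {E : Type*} [NormedAddCommGroup E] [NormedSpace ℝ E] [FiniteDimensional ℝ E] {A P : E →L[ℝ] E →L[ℝ] ℝ} {m : ℝ}, (∀ v : E, m * ‖v‖ ≤ ‖A v‖) → ‖P‖ < m → (A + P).IsInvertible := by
  intro E _ _ _ A P m hA hP
  refine MetricCoord.isInvertible_of_nondegenerate fun v hv ↦ injective_add_of_norm_lt A P hA hP ?_
  rw [map_zero]
  exact ContinuousLinearMap.ext fun w ↦ by rw [hv w]; rfl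

/-- The same with the margin phrased as `‖v‖ ≤ L‖A v‖` and the smallness as `‖P‖ L < 1` (if
`L ≤ 0` the space is trivial; otherwise `m = L⁻¹`). [cite: ONeill1983, Ch. 3 Lemma 3.4] -/
theorem isInvertible_add_of_norm_le_mul [FiniteDimensional ℝ E] {A P : E →L[ℝ] E →L[ℝ] ℝ} {L : ℝ}
    (hA : ∀ v : E, ‖v‖ ≤ L * ‖A v‖) (hP : ‖P‖ * L < 1) : (A + P).IsInvertible := by
  rcases le_or_gt L 0 with hL | hL
  · -- every vector is `0`: any margin above `‖P‖` works
    refine isInvertible_add_of_norm_lt_margin (m := ‖P‖ + 1) (fun v ↦ ?_) (lt_add_one _)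
    have hv : ‖v‖ ≤ 0 :=
      (hA v).trans (mul_nonpos_of_nonpos_of_nonneg hL (norm_nonneg _))
    rw [le_antisymm hv (norm_nonneg v), mul_zero]
    exact norm_nonneg _
  · refine isInvertible_add_of_norm_lt_margin (m := L⁻¹) (fun v ↦ ?_) ?_
    · rw [inv_mul_le_iff₀ hL]
      exact hA v
    · rw [← one_div, lt_div_iff₀ hL]
      exact hP

/-- **Invertible plus small is invertible**, finite-dimensional bilinear forms: if `A` is invertible
and `‖P‖ ‖A⁻¹‖ < 1` then `A + P` is invertible (`‖v‖ = ‖A⁻¹(A v)‖ ≤ ‖A⁻¹‖‖A v‖`).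
[cite: ONeill1983, Ch. 3 Lemma 3.4] -/
theorem isInvertible_add_of_isInvertible [FiniteDimensional ℝ E] {A P : E →L[ℝ] E →L[ℝ] ℝ}
    (hA : A.IsInvertible) (hP : ‖P‖ * ‖A.inverse‖ < 1) : (A + P).IsInvertible := by
  refine isInvertible_add_of_norm_le_mul (fun v ↦ ?_) hP
  have h := A.inverse.le_opNorm (A v)
  rwa [hA.inverse_apply_self] at h

/-! ### Symmetry passes to limits -/

/-- **A limit of (eventually) symmetric bilinear forms is symmetric**: if `Gᵢ → G₀` along a
nontrivial filter and eventually `Gᵢ(v, w) = Gᵢ(w, v)` for all `v, w`, then `G₀` is symmetric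
(evaluation `B ↦ B(v, w)` is continuous and limits are unique). Filter form of
`Literature.Geometry.Lorentzian.symm_of_tendsto_bilin`; with `…OmegaLimitGlue` it gives the symmetry
half of `MetricCoord.IsMetricOn` for ω-limits of symmetric fields (Hale 1980, Ch. I, §8: ω-limit sets
inherit closed constraints). [folklore] -/
theorem symm_of_tendsto {ι : Type*} {l : Filter ι} [l.NeBot] {G : ι → E →L[ℝ] E →L[ℝ] ℝ}
    {G₀ : E →L[ℝ] E →L[ℝ] ℝ} (h : Tendsto G l (𝓝 G₀))
    (hs : ∀ᶠ i in l, ∀ v w : E, G i v w = G i w v) (v w : E) : G₀ v w = G₀ w v := by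
  have hc : ∀ a b : E, Tendsto (fun i ↦ G i a b) l (𝓝 (G₀ a b)) := fun a b ↦
    (((ContinuousLinearMap.apply ℝ ℝ b).continuous.comp
      (ContinuousLinearMap.apply ℝ (E →L[ℝ] ℝ) a).continuous).tendsto G₀).comp h
  exact tendsto_nhds_unique_of_eventuallyEq (hc v w) (hc w v) (hs.mono fun i hi ↦ hi v w)

end General

/-! ### The crux setting: limit chart metrics `G + g_{M,a,Λ,c}(x)` on the boosted Kerr exterior -/

section BoostedKerr

variable (Λ : lorentzGroup) (c : E4) (M a : ℝ)

/-- **Margin form**: if `m‖v‖ ≤ ‖g_{M,a,Λ,c}(x)(v, ·)‖` for all `v` and `‖G‖ < m`, then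
`G + g_{M,a,Λ,c}(x)` is invertible (`isInvertible_add_of_norm_lt_margin`, commuted).
[cite: ONeill1983, Ch. 3 Lemma 3.4] -/
theorem isInvertible_add_boostedKerrBilin_of_norm_lt {x : E4} {G : E4 →L[ℝ] E4 →L[ℝ] ℝ} {m : ℝ}
    (hm : ∀ v : E4, m * ‖v‖ ≤ ‖boostedKerrBilin Λ c M a x v‖) (hG : ‖G‖ < m) :
    (G + boostedKerrBilin Λ c M a x).IsInvertible := by
  rw [add_comm]
  exact isInvertible_add_of_norm_lt_margin hm hG

/-- **Explicit Kerr–Schild margin**: wherever the rest-frame radius of `x` is positive,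
`‖v‖ ≤ ‖Λ‖²(1 + 4|H(Λ⁻¹(x − c))|) ‖g_{M,a,Λ,c}(x)(v, ·)‖`
(`SublinearIsFree.Slaving.norm_le_mul_norm_boostedKerrBilin`), so `G + g_{M,a,Λ,c}(x)` is
invertible as soon as `‖G‖ ‖Λ‖²(1 + 4|H|) < 1`. [cite: ONeill1983, Ch. 3 Lemma 3.4] -/
theorem isInvertible_add_boostedKerrBilin_of_mul_lt_one {x : E4}
    (hx : 0 < Kerr.radius a (poincareInv Λ c x)) {G : E4 →L[ℝ] E4 →L[ℝ] ℝ}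
    (hG : ‖G‖ * (‖((Λ : E4 ≃L[ℝ] E4) : E4 →L[ℝ] E4)‖ ^ 2 *
      (1 + 4 * |Kerr.scalarH M a (poincareInv Λ c x)|)) < 1) :
    (G + boostedKerrBilin Λ c M a x).IsInvertible := by
  rw [add_comm]
  exact isInvertible_add_of_norm_le_mul
    (SublinearIsFree.Slaving.norm_le_mul_norm_boostedKerrBilin Λ c M a hx) hG

/-- **Anchored limits are nondegenerate where the margin beats the anchor.** If `Gᵢ → G` along a
nontrivial filter with `‖Gᵢ‖ ≤ cst` eventually (e.g. the crux's all-time `C⁰` anchor `cst = 1/4` on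
the deviation translates), `m‖v‖ ≤ ‖g_{M,a,Λ,c}(x)(v, ·)‖` for all `v`, and `cst < m`, then
`G + g_{M,a,Λ,c}(x)` is invertible (`‖G‖ ≤ cst`: closed balls are closed, Hale 1980, Ch. I, §8).
[cite: Hale1980, Ch. I §8] -/
theorem isInvertible_add_boostedKerrBilin_of_tendsto {ι : Type*} {l : Filter ι} [l.NeBot] {x : E4}
    {Gs : ι → E4 →L[ℝ] E4 →L[ℝ] ℝ} {G : E4 →L[ℝ] E4 →L[ℝ] ℝ} {cst m : ℝ}
    (hlim : Tendsto Gs l (𝓝 G)) (hb : ∀ᶠ i in l, ‖Gs i‖ ≤ cst)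
    (hm : ∀ v : E4, m * ‖v‖ ≤ ‖boostedKerrBilin Λ c M a x v‖) (hc : cst < m) :
    (G + boostedKerrBilin Λ c M a x).IsInvertible :=
  isInvertible_add_boostedKerrBilin_of_norm_lt Λ c M a hm ((le_of_tendsto hlim.norm hb).trans_lt hc)

/-- **The deviation from a symmetric reference is symmetric**: if `g_B(y)` is symmetric then so is
`(Ψ^* 𝐠 − g_B)(y)` (extended by zero: on the domain `𝐠(dΨ v, dΨ w)` is symmetric because the
spacetime metric is, off the domain the value is `0`). [folklore] -/
theorem deviationExtend_symm (𝓢 : Spacetime 4) (B : ModelBackground) (Ψ : B.domain → 𝓢.carrier)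
    {y : E4} (hB : ∀ v w : E4, B.bilin y v w = B.bilin y w v) (v w : E4) :
    𝓢.deviationExtend B Ψ y v w = 𝓢.deviationExtend B Ψ y w v := by
  by_cases hy : y ∈ (B.domain : Set E4)
  · have h : 𝓢.deviationExtend B Ψ y = 𝓢.deviation B Ψ ⟨y, hy⟩ :=
      𝓢.deviationExtend_coe B Ψ ⟨y, hy⟩
    rw [h, Spacetime.deviation_apply, Spacetime.deviation_apply, 𝓢.metric.symm]
    exact congrArg _ (hB v w)
  · rw [𝓢.deviationExtend_of_not_mem B Ψ hy]
    rfl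

/-- **Limits of deviation values give symmetric chart metrics**: if the values
`(Ψ^* 𝐠 − g_{M,a})(yᵢ)` of the deviation of a hole chart on `boostedKerrBackground Λ c M a` converge
to `G` along a nontrivial filter (e.g. the translates `yᵢ = x + sᵢ e` of an ω-limit), then
`G + g_{M,a,Λ,c}(x)` is symmetric (`deviationExtend_symm`, `boostedKerrBilin_symm`,
`symm_of_tendsto`). [folklore] -/
theorem symm_add_boostedKerrBilin_of_tendsto (𝓢 : Spacetime 4)
    (Ψ : (boostedKerrBackground Λ c M a).domain → 𝓢.carrier) {ι : Type*} {l : Filter ι} [l.NeBot]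
    {y : ι → E4} {x : E4} {G : E4 →L[ℝ] E4 →L[ℝ] ℝ}
    (hlim : Tendsto (fun i ↦ 𝓢.deviationExtend (boostedKerrBackground Λ c M a) Ψ (y i)) l (𝓝 G))
    (v w : E4) :
    (G + boostedKerrBilin Λ c M a x) v w = (G + boostedKerrBilin Λ c M a x) w v := by
  have hG : G v w = G w v :=
    symm_of_tendsto hlim (Eventually.of_forall fun i ↦
      deviationExtend_symm 𝓢 (boostedKerrBackground Λ c M a) Ψ
        (boostedKerrBilin_symm Λ c M a (y i))) v w
  rw [add_apply, add_apply, add_apply, add_apply, hG, boostedKerrBilin_symm]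

/-- **Anchored ω-limits are metrics where the reference margin beats the anchor** (any filter of
translates). Let `Ψ` be a hole chart on `boostedKerrBackground Λ c M a`, `V` an open subset of the
boosted exterior, `g` of class `C^∞` on `V` (`exists_smoothOmegaLimit_hole_translate`), and along a
nontrivial filter let the deviation translates `(Ψ^* 𝐠 − g_{M,a})(x + sᵢ • e)` converge to `g x` and
be eventually bounded by `cst` in norm at every `x ∈ V` (the ANCHOR), while the reference form has a
margin `m(x)‖v‖ ≤ ‖g_{M,a,Λ,c}(x)(v, ·)‖` with `cst < m(x)` on `V`. Then the limit chart metric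
`g + g_{M,a,Λ,c}` is a field of metric components on `V` (`MetricCoord.IsMetricOn`: open, `C^∞` —
`g_{M,a,Λ,c}` is smooth on the exterior, `KerrSchildChart.contDiffAt_boostedKerrBilin` —, symmetric
by `symm_add_boostedKerrBilin_of_tendsto`, invertible by `isInvertible_add_boostedKerrBilin_of_tendsto`);
O'Neill 1983, Ch. 3, Def. 3.1. [cite: ONeill1983, Ch. 3 Def. 3.1] -/
theorem isMetricOn_omegaLimit_add_boostedKerrBilin (𝓢 : Spacetime 4)
    (Ψ : (boostedKerrBackground Λ c M a).domain → 𝓢.carrier) {g : E4 → E4 →L[ℝ] E4 →L[ℝ] ℝ}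
    {V : Set E4} (hVo : IsOpen V) (hV : V ⊆ (boostedKerrExterior Λ c M a : Set E4))
    (hg : ContDiffOn ℝ ∞ g V) {ι : Type*} {l : Filter ι} [l.NeBot] {s : ι → ℝ} {e : E4} {cst : ℝ}
    {m : E4 → ℝ}
    (hlim : ∀ x ∈ V, Tendsto
      (fun i ↦ 𝓢.deviationExtend (boostedKerrBackground Λ c M a) Ψ (x + s i • e)) l (𝓝 (g x)))
    (hb : ∀ x ∈ V, ∀ᶠ i in l,
      ‖𝓢.deviationExtend (boostedKerrBackground Λ c M a) Ψ (x + s i • e)‖ ≤ cst)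
    (hm : ∀ x ∈ V, ∀ v : E4, m x * ‖v‖ ≤ ‖boostedKerrBilin Λ c M a x v‖)
    (hc : ∀ x ∈ V, cst < m x) :
    MetricCoord.IsMetricOn (fun x ↦ g x + boostedKerrBilin Λ c M a x) V where
  isOpen := hVo
  contDiffOn := hg.add fun _ hx ↦
    (KerrSchildChart.contDiffAt_boostedKerrBilin Λ c M a (hV hx)).contDiffWithinAt
  symm x hx v w := symm_add_boostedKerrBilin_of_tendsto Λ c M a 𝓢 Ψ (hlim x hx) v w
  isInvertible x hx :=
    isInvertible_add_boostedKerrBilin_of_tendsto Λ c M a (hlim x hx) (hb x hx) (hm x hx) (hc x hx)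

/-- **Sequential form in the crux's currency.** Let `g` be an ω-limit of the deviation translates of
a hole chart `Ψ` along chart times `T n`, in the `supCkENorm`-on-compacts sense output by
`exists_omegaLimit_hole_translate` / `exists_smoothOmegaLimit_hole_translate` (any order `k`), with
`g` of class `C^∞` on the exterior; let `V` be an open subset of the exterior on which the translates
are eventually ANCHORED, `‖(Ψ^* 𝐠 − g_{M,a})(x + T n • e)‖ ≤ cst`, and the reference form has margin
`m(x) > cst`. Then `g + g_{M,a,Λ,c}` is a field of metric components on `V` — the hypothesis
`MetricCoord.IsMetricOn (fun x ↦ g x + boostedKerrBilin Λ c M a x) V` of `ricAt_hole_omegaLimit_eq_zero`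
(pointwise convergence at `x ∈ V` from the singleton `K = {x}`, `tendsto_translate_of_tendsto_supCkENorm`).
[cite: ONeill1983, Ch. 3 Def. 3.1] -/
theorem isMetricOn_hole_omegaLimit_add_boostedKerrBilin (𝓢 : Spacetime 4)
    (Ψ : (boostedKerrBackground Λ c M a).domain → 𝓢.carrier) {g : E4 → E4 →L[ℝ] E4 →L[ℝ] ℝ}
    (hg : ContDiffOn ℝ ∞ g (boostedKerrExterior Λ c M a : Set E4)) {V : Set E4} (hVo : IsOpen V)
    (hV : V ⊆ (boostedKerrExterior Λ c M a : Set E4)) {k : ℕ} {T : ℕ → ℝ} {e : E4} {cst : ℝ}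
    {m : E4 → ℝ}
    (hlim : ∀ K ⊆ (boostedKerrExterior Λ c M a : Set E4), IsCompact K →
      Tendsto (fun n ↦ supCkENorm K k (fun x ↦
        𝓢.deviationExtend (boostedKerrBackground Λ c M a) Ψ (x + T n • e) - g x)) atTop (𝓝 0))
    (hb : ∀ x ∈ V, ∀ᶠ n in atTop,
      ‖𝓢.deviationExtend (boostedKerrBackground Λ c M a) Ψ (x + T n • e)‖ ≤ cst)
    (hm : ∀ x ∈ V, ∀ v : E4, m x * ‖v‖ ≤ ‖boostedKerrBilin Λ c M a x v‖)
    (hc : ∀ x ∈ V, cst < m x) :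
    MetricCoord.IsMetricOn (fun x ↦ g x + boostedKerrBilin Λ c M a x) V :=
  isMetricOn_omegaLimit_add_boostedKerrBilin Λ c M a 𝓢 Ψ hVo hV (hg.mono hV)
    (fun x hx ↦ tendsto_translate_of_tendsto_supCkENorm (mem_singleton x)
      (hlim {x} (singleton_subset_iff.2 (hV hx)) isCompact_singleton)) hb hm hc

end BoostedKerr

end Summit.FinalStateConjecture.FinalStateConjecture.Theorems.ClusterCompleteness

end
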